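import Mathlib.Analysis.MellinTransform
import Mathlib.NumberTheory.LSeries.RiemannZeta
import Mathlib.Analysis.Distribution.SchwartzSpace.Basic
import HarnessLib

/-!
# Meyer's global difference representation — proofs, `K = ℚ`: the Mellin transform of a theta series

Topic `NumberTheory/Automorphic`; namespace `Literature.NumberTheory.Automorphic.Meyer`. Sibling
PROOF file (real analysis only: Mathlib's `mellin` and `riemannZeta`) for Step C/D of the plan for
`Meyer.spectralRealisation_rat` [Meyer2005, Thm. 5.11]: Riemann's unfolding of the Mellin transform
of the theta series `∑_{n ≥ 1} G(nt)` of a Schwartz function `G` on `ℝ` — the way the Fourier–Laplace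
transform of Meyer's summation map `Σ(G ⊗ 1_Ẑ)` on `C_ℚ` produces the zeta function
[Meyer2005, §5.7: "`L_K(χ, s)` is `\widehat{Σ f_χ}(χ|x|^s)` for suitable `f_χ ∈ 𝒮(𝔸_K)`"]:

* `schwartz_isBigO_atTop_rpow_neg`, `mellinConvergent_schwartz` — the Mellin integral of a Schwartz
  function converges for `Re s > 0`;
* `integral_norm_mellin_integrand_comp_mul` — `∫₀^∞ ‖t^{s-1} G(a t)‖ dt = a^{-Re s} ∫₀^∞ t^{Re s - 1} ‖G(t)‖ dt`;
* **`hasSum_mellin_comp_nat_mul`, `mellin_tsum_comp_nat_mul`** — for `1 < Re s`,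
  `mellin (t ↦ ∑_{n ≥ 1} G(nt)) s = ζ(s) · mellin G s` (termwise integration, the dilation rule
  `mellin (G(a ·)) s = a^{-s} mellin G s`, and `ζ(s) = ∑ n^{-s}`);
* `tsum_int_ite_eq_two_mul_tsum_nat` — for even `G`, `∑_{n ∈ ℤ, n ≠ 0} G(nt) = 2 ∑_{n ≥ 1} G(nt)`;
  **`mellin_tsum_int_ite`** — `mellin (t ↦ ∑_{n ≠ 0} G(nt)) s = 2 ζ(s) mellin G s` (`1 < Re s`), the
  form matching `meyerSum_ratTensor_eq` of `MeyerRatTheta`.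

Everything is proved; no definitions, no named facts.

## References

* R. Meyer, *On a representation of the idele class group related to primes and zeros of
  L-functions*, Duke Math. J. 127 (2005) = arXiv:math/0311468, §5.7 [Meyer2005].
* B. Riemann, *Ueber die Anzahl der Primzahlen unter einer gegebenen Grösse* (1859) (the unfolding
  `∫₀^∞ ψ(x) x^{s/2-1} dx = ζ(s) Γ(s/2) π^{-s/2}`).
-/

noncomputable section

open MeasureTheory Set Filter Asymptotics
open scoped Topology

namespace Literature.NumberTheory.Automorphic.Meyer

section Convergence

/-- A Schwartz function on `ℝ` is `O(t^{-a})` at `+∞`, for every `a`. [folklore] -/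
theorem schwartz_isBigO_atTop_rpow_neg (G : SchwartzMap ℝ ℂ) (a : ℝ) :
    (fun t : ℝ => G t) =O[atTop] fun t : ℝ => t ^ (-a) := by
  have h : (fun t : ℝ => G t) =O[atTop] fun t : ℝ => ‖t‖ ^ (-a) :=
    (G.isBigO_cocompact_rpow (-a)).mono atTop_le_cocompact
  refine h.congr' EventuallyEq.rfl ?_
  filter_upwards [eventually_ge_atTop (0 : ℝ)] with t ht
  rw [Real.norm_of_nonneg ht]

/-- A Schwartz function on `ℝ` is bounded near `0⁺`: `O(t^{-0})`. [folklore] -/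
theorem schwartz_isBigO_nhdsGT_zero (G : SchwartzMap ℝ ℂ) :
    (fun t : ℝ => G t) =O[𝓝[>] (0 : ℝ)] fun t : ℝ => t ^ (-(0 : ℝ)) := by
  refine IsBigO.of_bound (SchwartzMap.seminorm ℝ 0 0 G) (Eventually.of_forall fun t => ?_)
  rw [neg_zero, Real.rpow_zero, norm_one, mul_one]
  exact SchwartzMap.norm_le_seminorm ℝ G t

/-- **The Mellin integral of a Schwartz function converges for `Re s > 0`.** [folklore] -/
theorem mellinConvergent_schwartz (G : SchwartzMap ℝ ℂ) {s : ℂ} (hs : 0 < s.re) :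
    MellinConvergent (fun t : ℝ => G t) s :=
  mellinConvergent_of_isBigO_rpow (G.continuous.locallyIntegrable.locallyIntegrableOn _)
    (schwartz_isBigO_atTop_rpow_neg G (s.re + 1)) (by linarith) (schwartz_isBigO_nhdsGT_zero G) (by simpa using hs)

/-- **The norm of the Mellin integrand of a dilate**: for `a > 0`,
`∫₀^∞ ‖t^{s-1} G(a t)‖ dt = a^{-Re s} ∫₀^∞ t^{Re s - 1} ‖G t‖ dt`. [folklore] -/
theorem integral_norm_mellin_integrand_comp_mul (G : ℝ → ℂ) (s : ℂ) {a : ℝ} (ha : 0 < a) :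
    ∫ t in Ioi (0 : ℝ), ‖(t : ℂ) ^ (s - 1) • G (a * t)‖ =
      a ^ (-s.re) * ∫ t in Ioi (0 : ℝ), t ^ (s.re - 1) * ‖G t‖ := by
  have hpt : ∀ t ∈ Ioi (0 : ℝ), ‖(t : ℂ) ^ (s - 1) • G (a * t)‖ =
      a ^ (1 - s.re) * ((a * t) ^ (s.re - 1) * ‖G (a * t)‖) := by
    intro t ht
    have ht' : 0 < t := ht
    rw [norm_smul, Complex.norm_cpow_eq_rpow_re_of_pos ht', Complex.sub_re, Complex.one_re,
      Real.mul_rpow ha.le ht'.le, ← mul_assoc, ← mul_assoc, ← Real.rpow_add ha]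
    have : 1 - s.re + (s.re - 1) = 0 := by ring
    rw [this, Real.rpow_zero, one_mul]
  rw [setIntegral_congr_fun measurableSet_Ioi hpt, integral_const_mul,
    integral_comp_mul_left_Ioi (fun u : ℝ => u ^ (s.re - 1) * ‖G u‖) 0 ha, mul_zero, smul_eq_mul,
    ← mul_assoc]
  congr 1
  rw [Real.rpow_sub ha, Real.rpow_one, Real.rpow_neg ha.le]
  field_simp

end Convergence

/-! ### Riemann's unfolding -/

section Unfolding

/-- **Riemann's unfolding, `HasSum` form**: for a Schwartz function `G` and `1 < Re s`,
`mellin (t ↦ ∑_{n≥1} G(nt)) s = ∑_{n≥1} n^{-s} · mellin G s`. [cite: Meyer2005, §5.7] -/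
theorem hasSum_mellin_comp_nat_mul (G : SchwartzMap ℝ ℂ) {s : ℂ} (hs : 1 < s.re) :
    HasSum (fun n : ℕ => (((n + 1 : ℕ) : ℝ) : ℂ) ^ (-s) * mellin (fun t : ℝ => G t) s)
      (mellin (fun t : ℝ => ∑' n : ℕ, G (((n + 1 : ℕ) : ℝ) * t)) s) := by
  set F : ℕ → ℝ → ℂ := fun n t => (t : ℂ) ^ (s - 1) • G (((n + 1 : ℕ) : ℝ) * t) with hF
  have hpos : ∀ n : ℕ, (0 : ℝ) < ((n + 1 : ℕ) : ℝ) := fun n => by positivity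
  -- integrability of the terms
  have hint : ∀ n : ℕ, Integrable (F n) (volume.restrict (Ioi (0 : ℝ))) := fun n =>
    (MellinConvergent.comp_mul_left (f := fun t : ℝ => G t) (s := s) (hpos n)).mpr
      (mellinConvergent_schwartz G (by linarith))
  -- summability of the integrals of the norms
  set I : ℝ := ∫ t in Ioi (0 : ℝ), t ^ (s.re - 1) * ‖G t‖ with hI
  have hnorm : ∀ n : ℕ, ∫ t in Ioi (0 : ℝ), ‖F n t‖ = (((n + 1 : ℕ) : ℝ) ^ s.re)⁻¹ * I := by
    intro n
    rw [hF]
    simp only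
    rw [integral_norm_mellin_integrand_comp_mul (fun t : ℝ => G t) s (hpos n), Real.rpow_neg (hpos n).le]
  have hsum : Summable fun n : ℕ => ∫ t in Ioi (0 : ℝ), ‖F n t‖ := by
    have h1 : Summable fun n : ℕ => (((n : ℝ) ^ s.re)⁻¹ : ℝ) := Real.summable_nat_rpow_inv.mpr hs
    have h2 : Summable fun n : ℕ => ((((n + 1 : ℕ) : ℝ) ^ s.re)⁻¹ : ℝ) :=
      (summable_nat_add_iff 1).mpr h1
    exact (h2.mul_right I).congr fun n => (hnorm n).symm
  have H := hasSum_integral_of_summable_integral_norm hint hsum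
  -- identify both sides
  have hterm : ∀ n : ℕ, ∫ t in Ioi (0 : ℝ), F n t =
      (((n + 1 : ℕ) : ℝ) : ℂ) ^ (-s) * mellin (fun t : ℝ => G t) s := by
    intro n
    have h := mellin_comp_mul_left (fun t : ℝ => G t) s (hpos n)
    rw [mellin] at h
    rw [hF]
    simp only
    rw [h, smul_eq_mul]
  have htot : (∫ t in Ioi (0 : ℝ), ∑' n : ℕ, F n t) =
      mellin (fun t : ℝ => ∑' n : ℕ, G (((n + 1 : ℕ) : ℝ) * t)) s := by
    rw [mellin]
    refine setIntegral_congr_fun measurableSet_Ioi fun t _ => ?_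
    rw [hF]
    simp only [smul_eq_mul]
    exact tsum_mul_left
  simp_rw [hterm] at H
  rw [htot] at H
  exact H

/-- **Riemann's unfolding**: for a Schwartz function `G` on `ℝ` and `1 < Re s`,
`mellin (t ↦ ∑_{n≥1} G(nt)) s = ζ(s) · mellin G s`. [cite: Meyer2005, §5.7] -/
theorem mellin_tsum_comp_nat_mul (G : SchwartzMap ℝ ℂ) {s : ℂ} (hs : 1 < s.re) :
    mellin (fun t : ℝ => ∑' n : ℕ, G (((n + 1 : ℕ) : ℝ) * t)) s =
      riemannZeta s * mellin (fun t : ℝ => G t) s := by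
  rw [← (hasSum_mellin_comp_nat_mul G hs).tsum_eq, tsum_mul_right, zeta_eq_tsum_one_div_nat_add_one_cpow hs]
  congr 1
  refine tsum_congr fun n => ?_
  rw [one_div, ← Complex.cpow_neg]
  push_cast
  ring_nf

/-- For an even function, `∑_{n ∈ ℤ, n ≠ 0} G(nt) = 2 ∑_{n ≥ 1} G(nt)` (when the latter converges).
[folklore] -/
theorem tsum_int_ite_eq_two_mul_tsum_nat (G : ℝ → ℂ) (heven : ∀ t, G (-t) = G t) {t : ℝ}
    (hsum : Summable fun n : ℕ => G (((n + 1 : ℕ) : ℝ) * t)) :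
    (∑' n : ℤ, if n = 0 then (0 : ℂ) else G (n * t)) = 2 * ∑' n : ℕ, G (((n + 1 : ℕ) : ℝ) * t) := by
  set f : ℤ → ℂ := fun n => if n = 0 then (0 : ℂ) else G (n * t) with hf
  set S : ℂ := ∑' n : ℕ, G (((n + 1 : ℕ) : ℝ) * t) with hS
  have hnat : HasSum (fun n : ℕ => f n) S := by
    have h1 : HasSum (fun n : ℕ => f ((n + 1 : ℕ) : ℤ)) S := by
      have : (fun n : ℕ => f ((n + 1 : ℕ) : ℤ)) = fun n : ℕ => G (((n + 1 : ℕ) : ℝ) * t) := by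
        funext n
        rw [hf]
        simp only [Nat.cast_add, Nat.cast_one]
        rw [if_neg (by positivity)]
        push_cast
        ring_nf
      rw [this]
      exact hsum.hasSum
    have h2 := (hasSum_nat_add_iff (f := fun n : ℕ => f n) 1).mp h1
    have hf0 : f 0 = 0 := by rw [hf]; simp
    simpa [Finset.sum_range_one, hf0] using h2
  have hneg : HasSum (fun n : ℕ => f (-(n + 1 : ℤ))) S := by
    have : (fun n : ℕ => f (-(n + 1 : ℤ))) = fun n : ℕ => G (((n + 1 : ℕ) : ℝ) * t) := by
      funext n
      rw [hf]
      simp only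
      rw [if_neg (by omega)]
      push_cast
      rw [neg_mul, heven]
    rw [this]
    exact hsum.hasSum
  have h := HasSum.of_nat_of_neg_add_one hnat hneg
  rw [h.tsum_eq, two_mul]

/-- Summability of `n ↦ G(nt)` over `n ≥ 1` for a Schwartz function and `t > 0`. [folklore] -/
theorem summable_schwartz_comp_nat_mul (G : SchwartzMap ℝ ℂ) {t : ℝ} (ht : 0 < t) :
    Summable fun n : ℕ => G (((n + 1 : ℕ) : ℝ) * t) := by
  -- `‖x‖² ‖G x‖ ≤ C`, so `‖G(nt)‖ ≤ C / (n t)²`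
  set C := SchwartzMap.seminorm ℝ 2 0 G with hC
  refine Summable.of_norm_bounded (g := fun n : ℕ => C / ((((n + 1 : ℕ) : ℝ)) * t) ^ 2) ?_ fun n => ?_
  · have h := (summable_nat_add_iff (f := fun n : ℕ => (((n : ℝ)) ^ 2)⁻¹) 1).mpr
      (Real.summable_nat_pow_inv.mpr one_lt_two)
    refine (h.mul_left (C / t ^ 2)).congr fun n => ?_
    have ht0 : t ≠ 0 := ht.ne'
    have hn0 : ((n + 1 : ℕ) : ℝ) ≠ 0 := by positivity
    field_simp
  · have hx : 0 < ((n + 1 : ℕ) : ℝ) * t := mul_pos (by positivity) ht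
    have hle := SchwartzMap.le_seminorm ℝ 2 0 G ((((n + 1 : ℕ) : ℝ)) * t)
    rw [norm_iteratedFDeriv_zero, Real.norm_of_nonneg hx.le] at hle
    rw [le_div_iff₀ (pow_pos hx 2), mul_comm]
    exact hle

/-- **Riemann's unfolding for the two-sided theta sum of an even Schwartz function**:
`mellin (t ↦ ∑_{n ∈ ℤ, n ≠ 0} G(nt)) s = 2 ζ(s) mellin G s` for `1 < Re s` — the Mellin transform of
`Σ(G ⊗ 1_Ẑ)` read on `ℝ_{>0}` (`meyerSum_ratTensor_eq`). [cite: Meyer2005, §5.7] -/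
theorem mellin_tsum_int_ite (G : SchwartzMap ℝ ℂ) (heven : ∀ t, G (-t) = G t) {s : ℂ} (hs : 1 < s.re) :
    mellin (fun t : ℝ => ∑' n : ℤ, if n = 0 then (0 : ℂ) else G (n * t)) s =
      2 * riemannZeta s * mellin (fun t : ℝ => G t) s := by
  have h1 : mellin (fun t : ℝ => ∑' n : ℤ, if n = 0 then (0 : ℂ) else G (n * t)) s =
      mellin (fun t : ℝ => (2 : ℂ) • ∑' n : ℕ, G (((n + 1 : ℕ) : ℝ) * t)) s := by
    rw [mellin, mellin]
    refine setIntegral_congr_fun measurableSet_Ioi fun t ht => ?_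
    simp only [smul_eq_mul]
    rw [tsum_int_ite_eq_two_mul_tsum_nat (fun t : ℝ => G t) heven (summable_schwartz_comp_nat_mul G ht)]
  rw [h1, mellin_const_smul, mellin_tsum_comp_nat_mul G hs, smul_eq_mul, mul_assoc]

end Unfolding

end Literature.NumberTheory.Automorphic.Meyer
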